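import Summits.KontsevichZagierPeriods.KontsevichZagierPeriods.Theorems.SoloInformedToricAkCharts
import HarnessLib

/-!
# The DEN-calculus: presentable denominators and the rules ND, VERTEX, DIAG

Solo programme `solo-KontsevichZagierPeriods-informed`, session s106 (cube crux
`SoloInformedAyoubCubeResolutionCube`; makes the calculus-internal resolution algorithm of
THEOREM CUSP / THEOREM A_k compositional).

A polynomial `Q ∈ ℚ[x₁, …, xₙ]` is a **presentable denominator** (`SoloInformedPresentableDen Q`)
if for EVERY numerator `P ∈ ℚ[x]` and every `IntegralRep` `r = [σ, f]` with
`(0,1)ⁿ ⊆ σ ⊆ [0,1]ⁿ` and `f = P/Q` on the open cube, `of r` is presentable (the cube crux with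
`k = 1`).  The property depends only on `Q` as a function on the open cube
(`soloInformed_presentableDen_congr`) and it suffices to test it on the open cube
(`soloInformed_presentableDen_of_open`).  Three rules generate presentable denominators:

* **RULE ND** `soloInformed_presentableDen_of_nondegenerate`: cube-nondegenerate `Q`
  (THEOREM ND-GEN);
* **RULE VERTEX** `soloInformed_presentableDen_of_vertexReflect`: if `Q ≠ 0` on the open cube and
  some vertex reflection `vertexReflect S Q` is a presentable denominator, so is `Q` (rule (2)
  along the vertex move `Φ_S`, `|det| = 1`) — with RULE ND this is THEOREM VERTEX;
* **RULE DIAG** `soloInformed_presentableDen_of_diag` (`n = 2`): if `Q(0,0) = 0`, `Q ≠ 0` on the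
  open square, and the two chart denominators `Q_low = Q(v₀, v₀v₁)/v₀` and
  `Q_up = Q(u₀u₁, u₁)/u₁` (one power of the exceptional coordinate is absorbed by the Jacobian)
  are presentable denominators, so is `Q` (THEOREM DIAG: the blow-up of the origin read in the
  two triangle charts of the square).

As a demonstration the whole `A`-family of THEOREM A_k is re-derived inside the calculus in a
few lines (`soloInformed_presentableDen_ak`): DIAG, then VERTEX at the far vertex of each chart
square, then ND.  The rules are the three move types of an embedded resolution of plane curve
singularities inside the unit square; what the iteration still lacks is a box-split / rescaling
rule separating zeros on opposite faces (next file).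

References: M. Kontsevich, D. Zagier, *Periods* (2001) §1.2 rules (1)–(2); A. N. Varchenko,
Funct. Anal. Appl. 10 (1976); W. Fulton, *Introduction to Toric Varieties* (1993) §2.6.
-/

noncomputable section

open scoped BigOperators
open MeasureTheory Set
open Literature.NumberTheory.Transcendental Literature.NumberTheory.Transcendental.KZ
open Literature.ModelTheory.ExponentialFields (IsSemialgebraic)

namespace Summit.KontsevichZagierPeriods.KontsevichZagierPeriods.Theorems

variable {n : ℕ}

/-! ## Presentable denominators -/

/-- `Q` is a **presentable denominator**: every `[σ, P/Q]` with `(0,1)ⁿ ⊆ σ ⊆ [0,1]ⁿ` is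
presentable, for every numerator `P ∈ ℚ[x]`. [this work] -/
def SoloInformedPresentableDen (Q : MvPolynomial (Fin n) ℚ) : Prop :=
  ∀ (P : MvPolynomial (Fin n) ℚ) (r : IntegralRep n), soloInformedOpenCube n ⊆ r.domain →
    r.domain ⊆ soloInformedCube n →
    EqOn r.integrand (fun x => MvPolynomial.aeval x P / MvPolynomial.aeval x Q)
      (soloInformedOpenCube n) →
    of r ∈ soloInformedPresentable

/-- **The open cube suffices**: `∂[0,1]ⁿ` is null (rule (1a)). [this work] -/
theorem soloInformed_presentableDen_of_open (Q : MvPolynomial (Fin n) ℚ)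
    (h : ∀ (P : MvPolynomial (Fin n) ℚ) (ρ : IntegralRep n), ρ.domain = soloInformedOpenCube n →
      EqOn ρ.integrand (fun x => MvPolynomial.aeval x P / MvPolynomial.aeval x Q)
        (soloInformedOpenCube n) → of ρ ∈ soloInformedPresentable) :
    SoloInformedPresentableDen Q := by
  intro P r hO hC hri
  set r₀ := r.restrict (soloInformedOpenCube n) (isSemialgebraic_soloInformedOpenCube n) hO
    with hr₀
  have h₀ : of r - of r₀ ∈ relations :=
    r.of_sub_of_restrict_mem_relations (isSemialgebraic_soloInformedOpenCube n) hO
      (measure_mono_null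
        (show r.domain \ soloInformedOpenCube n ⊆ soloInformedCube n \ soloInformedOpenCube n from
          fun _ hx => ⟨hC hx.1, hx.2⟩)
        (soloInformed_volume_cube_diff_openCube n))
  exact soloInformed_presentable_of_sub_mem h₀ (h P r₀ rfl fun x hx => hri hx)

/-- A presentable denominator depends only on its values on the open cube. [this work] -/
theorem soloInformed_presentableDen_congr {Q Q' : MvPolynomial (Fin n) ℚ}
    (hQQ' : ∀ x ∈ soloInformedOpenCube n, MvPolynomial.aeval x Q = MvPolynomial.aeval x Q')
    (h : SoloInformedPresentableDen Q) : SoloInformedPresentableDen Q' :=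
  fun P r hO hC hri => h P r hO hC fun x hx => (hri hx).trans (by simp only [hQQ' x hx])

/-- A presentable denominator in the output format of the cube crux
`SoloInformedAyoubCubeResolutionCube` (`k = 1`). [this work] -/
theorem soloInformed_cubeResolution_of_presentableDen {Q : MvPolynomial (Fin n) ℚ}
    (hQ : SoloInformedPresentableDen Q) (P : MvPolynomial (Fin n) ℚ) (r : IntegralRep n)
    (hr : r.domain = soloInformedCube n)
    (hri : EqOn r.integrand (fun x => MvPolynomial.aeval x P / MvPolynomial.aeval x Q)
      (soloInformedOpenCube n)) :
    ∃ (k : ℕ) (_ : k ≠ 0) (m' : ℕ) (d : Fin m' → ℕ) (G : ∀ j, SoloInformedCubeGerm (d j))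
      (c : Fin m' → ℤ) (ρ : ∀ j, IntegralRep (d j)),
      (∀ j, (ρ j).domain = soloInformedCube (d j)) ∧
      (∀ j, EqOn (ρ j).integrand (fun x => ((G j).g (soloInformedToC (d j) x)).re)
        (soloInformedCube (d j))) ∧
      k • of r - ∑ j, c j • of (ρ j) ∈ relations :=
  soloInformed_exists_fin_of_presentable
    (hQ P r (hr ▸ soloInformedOpenCube_subset_cube n) hr.le hri)

/-! ## RULE ND and RULE VERTEX -/

/-- **RULE ND.**  A cube-nondegenerate polynomial is a presentable denominator
(THEOREM ND-GEN). [this work] -/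
theorem soloInformed_presentableDen_of_nondegenerate {Q : MvPolynomial (Fin n) ℚ}
    (hND : SoloInformedCubeNondegenerate Q) : SoloInformedPresentableDen Q :=
  soloInformed_presentableDen_of_open Q fun P ρ hρ hρi =>
    soloInformed_presentable_of_nondegenerate_rational_open P Q hND ρ hρ hρi

/-- **RULE VERTEX.**  If `Q` has no zero on the open cube and some vertex reflection
`vertexReflect S Q` is a presentable denominator, then `Q` is a presentable denominator:
rule (2) along the vertex move `Φ_S` (`|det Φ_S'| = 1`) turns `[(0,1)ⁿ, P/Q]` into
`[(0,1)ⁿ, vertexReflect S P / vertexReflect S Q]`. [this work] -/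
theorem soloInformed_presentableDen_of_vertexReflect (S : Finset (Fin n))
    {Q : MvPolynomial (Fin n) ℚ} (hQ : ∀ x ∈ soloInformedOpenCube n, MvPolynomial.aeval x Q ≠ 0)
    (h : SoloInformedPresentableDen (soloInformedVertexReflect S Q)) :
    SoloInformedPresentableDen Q := by
  refine soloInformed_presentableDen_of_open Q fun P ρ hρ hρi => ?_
  have hQt : ∀ x ∈ soloInformedOpenCube n,
      MvPolynomial.aeval x (soloInformedVertexReflect S Q) ≠ 0 := fun x hx => by
    rw [soloInformed_aeval_vertexReflect]
    exact hQ _ (soloInformed_vertexMove_mem S hx)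
  have hint : IntegrableOn (fun x => MvPolynomial.aeval x P / MvPolynomial.aeval x Q)
      (soloInformedOpenCube n) := by
    have h := ρ.integrableOn.congr_fun (fun x hx => hρi (by rwa [hρ] at hx))
      ρ.measurableSet_domain_holds
    rwa [hρ] at h
  have hint' : IntegrableOn (fun x => MvPolynomial.aeval x (soloInformedVertexReflect S P) /
      MvPolynomial.aeval x (soloInformedVertexReflect S Q)) (soloInformedOpenCube n) := by
    have hmeas : MeasurableSet (soloInformedOpenCube n) := hρ ▸ ρ.measurableSet_domain_holds
    have h := (integrableOn_image_iff_integrableOn_abs_det_fderiv_smul volume hmeas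
      (fun x _ => (soloInformed_hasFDerivAt_vertexMove S x).hasFDerivWithinAt)
      (soloInformed_vertexMove_injective S).injOn
      (fun x => MvPolynomial.aeval x P / MvPolynomial.aeval x Q)).1
      (by rw [soloInformed_image_vertexMove]; exact hint)
    refine h.congr_fun (fun x _ => ?_) hmeas
    simp only [soloInformed_abs_det_vertexDeriv, one_smul, soloInformed_aeval_vertexReflect]
  -- rule (2) along the vertex move
  set ρt := IntegralRep.ofRational (soloInformedOpenCube n) (soloInformedVertexReflect S P)
      (soloInformedVertexReflect S Q) (isSemialgebraic_soloInformedOpenCube n) hQt hint'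
    with hρt
  have h2 : of ρt - of ρ ∈ relations := by
    refine changeOfVariablesRel_subset_relations ⟨n, ρt, ρ, soloInformedVertexMove S,
      fun _ => soloInformedVertexDeriv S,
      soloInformed_isSemialgebraicMapOn_vertexMove S (isSemialgebraic_soloInformedOpenCube n),
      fun x _ => (soloInformed_hasFDerivAt_vertexMove S x).hasFDerivWithinAt,
      (soloInformed_vertexMove_injective S).injOn, ?_, fun x hx => ?_, rfl⟩
    · show ρ.domain = soloInformedVertexMove S '' soloInformedOpenCube n
      rw [soloInformed_image_vertexMove, hρ]
    · have hx' : x ∈ soloInformedOpenCube n := hx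
      show MvPolynomial.aeval x (soloInformedVertexReflect S P) /
          MvPolynomial.aeval x (soloInformedVertexReflect S Q) = _
      rw [hρi (soloInformed_vertexMove_mem S hx'), soloInformed_abs_det_vertexDeriv, mul_one,
        soloInformed_aeval_vertexReflect, soloInformed_aeval_vertexReflect]
  have hpres : of ρt ∈ soloInformedPresentable :=
    h (soloInformedVertexReflect S P) ρt subset_rfl (soloInformedOpenCube_subset_cube n)
      fun _ _ => rfl
  rw [← neg_sub] at h2
  exact soloInformed_presentable_of_sub_mem (by simpa using relations.neg_mem h2) hpres

/-- RULE VERTEX + RULE ND = THEOREM VERTEX: `Q` is a presentable denominator as soon as some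
vertex reflection of `Q` is cube-nondegenerate. [this work] -/
theorem soloInformed_presentableDen_of_vertexReflect_nondegenerate (S : Finset (Fin n))
    {Q : MvPolynomial (Fin n) ℚ}
    (hND : SoloInformedCubeNondegenerate (soloInformedVertexReflect S Q)) :
    SoloInformedPresentableDen Q :=
  soloInformed_presentableDen_of_vertexReflect S
    (fun _ hx => soloInformed_aeval_ne_zero_of_vertexReflect_nondegenerate S hND hx)
    (soloInformed_presentableDen_of_nondegenerate hND)

/-! ## RULE DIAG (the blow-up of the origin of the square) -/

/-- The lower chart denominator `Q_low = Q(v₀, v₀v₁) / v₀`. -/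
def soloInformedDiagLower (Q : MvPolynomial (Fin 2) ℚ) : MvPolynomial (Fin 2) ℚ :=
  soloInformedChartQuot soloInformedLowerMat Q ![1, 0]

/-- The upper chart denominator `Q_up = Q(u₀u₁, u₁) / u₁`. -/
def soloInformedDiagUpper (Q : MvPolynomial (Fin 2) ℚ) : MvPolynomial (Fin 2) ℚ :=
  soloInformedChartQuot soloInformedUpperMat Q ![0, 1]

/-- A polynomial without constant term has only exponents of positive total degree. -/
theorem soloInformed_one_le_of_mem_support {Q : MvPolynomial (Fin 2) ℚ}
    (hQ0 : MvPolynomial.coeff 0 Q = 0) {a : Fin 2 →₀ ℕ} (ha : a ∈ Q.support) :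
    1 ≤ a 0 + a 1 := by
  rcases Nat.eq_zero_or_pos (a 0 + a 1) with h | h
  · exfalso
    have ha0 : a = 0 := by
      ext i
      fin_cases i <;> simp <;> omega
    rw [ha0] at ha
    exact (MvPolynomial.mem_support_iff.1 ha) hQ0
  · exact h

/-- `Q(v₀, v₀v₁) = v₀ · Q_low(v)` when `Q(0,0) = 0`. [this work] -/
theorem soloInformed_aeval_lowerChart_eq_mul_diagLower (Q : MvPolynomial (Fin 2) ℚ)
    (hQ0 : MvPolynomial.coeff 0 Q = 0) (v : Fin 2 → ℝ) :
    MvPolynomial.aeval (fun i => ∏ j, v j ^ soloInformedLowerMat i j) Q =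
      v 0 * MvPolynomial.aeval v (soloInformedDiagLower Q) := by
  have h := soloInformed_aeval_monomialMap_eq soloInformedLowerMat Q ![1, 0] (fun a ha j => by
    fin_cases j
    · simpa [soloInformedLowerMat, Fin.sum_univ_two] using soloInformed_one_le_of_mem_support hQ0 ha
    · simp) v
  rw [h, soloInformedDiagLower, Fin.prod_univ_two]
  simp

/-- `Q(u₀u₁, u₁) = u₁ · Q_up(u)` when `Q(0,0) = 0`. [this work] -/
theorem soloInformed_aeval_upperChart_eq_mul_diagUpper (Q : MvPolynomial (Fin 2) ℚ)
    (hQ0 : MvPolynomial.coeff 0 Q = 0) (v : Fin 2 → ℝ) :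
    MvPolynomial.aeval (fun i => ∏ j, v j ^ soloInformedUpperMat i j) Q =
      v 1 * MvPolynomial.aeval v (soloInformedDiagUpper Q) := by
  have h := soloInformed_aeval_monomialMap_eq soloInformedUpperMat Q ![0, 1] (fun a ha j => by
    fin_cases j
    · simp
    · simpa [soloInformedUpperMat, Fin.sum_univ_two] using
        soloInformed_one_le_of_mem_support hQ0 ha) v
  rw [h, soloInformedDiagUpper, Fin.prod_univ_two]
  simp

/-- `Q_low ≠ 0` on the open square if `Q ≠ 0` there. [this work] -/
theorem soloInformed_aeval_diagLower_ne_zero (Q : MvPolynomial (Fin 2) ℚ)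
    (hQ0 : MvPolynomial.coeff 0 Q = 0)
    (hQ : ∀ x ∈ soloInformedOpenCube 2, MvPolynomial.aeval x Q ≠ 0) (v : Fin 2 → ℝ)
    (hv : v ∈ soloInformedOpenCube 2) : MvPolynomial.aeval v (soloInformedDiagLower Q) ≠ 0 := by
  intro h0
  have hmem : (fun i => ∏ j, v j ^ soloInformedLowerMat i j) ∈ soloInformedOpenCube 2 :=
    soloInformedLowerTri_subset_openCube (soloInformed_image_lowerChart ▸ mem_image_of_mem _ hv)
  exact hQ _ hmem (by rw [soloInformed_aeval_lowerChart_eq_mul_diagLower Q hQ0 v, h0, mul_zero])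

/-- `Q_up ≠ 0` on the open square if `Q ≠ 0` there. [this work] -/
theorem soloInformed_aeval_diagUpper_ne_zero (Q : MvPolynomial (Fin 2) ℚ)
    (hQ0 : MvPolynomial.coeff 0 Q = 0)
    (hQ : ∀ x ∈ soloInformedOpenCube 2, MvPolynomial.aeval x Q ≠ 0) (v : Fin 2 → ℝ)
    (hv : v ∈ soloInformedOpenCube 2) : MvPolynomial.aeval v (soloInformedDiagUpper Q) ≠ 0 := by
  intro h0
  have hmem : (fun i => ∏ j, v j ^ soloInformedUpperMat i j) ∈ soloInformedOpenCube 2 :=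
    soloInformedUpperTri_subset_openCube (soloInformed_image_upperChart ▸ mem_image_of_mem _ hv)
  exact hQ _ hmem (by rw [soloInformed_aeval_upperChart_eq_mul_diagUpper Q hQ0 v, h0, mul_zero])

/-- The pulled-back form along the lower chart: `f(v₀, v₀v₁) v₀ = P_low(v)/Q_low(v)`.
[this work] -/
theorem soloInformed_diag_lowerChart_form (P Q : MvPolynomial (Fin 2) ℚ)
    (hQ0 : MvPolynomial.coeff 0 Q = 0)
    (hQ : ∀ x ∈ soloInformedOpenCube 2, MvPolynomial.aeval x Q ≠ 0) (v : Fin 2 → ℝ)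
    (hv : v ∈ soloInformedOpenCube 2) :
    MvPolynomial.aeval (fun i => ∏ j, v j ^ soloInformedLowerMat i j) P /
        MvPolynomial.aeval (fun i => ∏ j, v j ^ soloInformedLowerMat i j) Q * v 0 =
      MvPolynomial.aeval v (soloInformedChartQuot soloInformedLowerMat P 0) /
        MvPolynomial.aeval v (soloInformedDiagLower Q) := by
  rw [soloInformed_aeval_lowerChart_eq_mul_diagLower Q hQ0 v,
    soloInformed_aeval_monomialMap_chartQuot_zero soloInformedLowerMat P v]
  have h0 : v 0 ≠ 0 := (hv 0).1.ne'
  have hq := soloInformed_aeval_diagLower_ne_zero Q hQ0 hQ v hv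
  field_simp

/-- The pulled-back form along the upper chart: `f(u₀u₁, u₁) u₁ = P_up(u)/Q_up(u)`.
[this work] -/
theorem soloInformed_diag_upperChart_form (P Q : MvPolynomial (Fin 2) ℚ)
    (hQ0 : MvPolynomial.coeff 0 Q = 0)
    (hQ : ∀ x ∈ soloInformedOpenCube 2, MvPolynomial.aeval x Q ≠ 0) (v : Fin 2 → ℝ)
    (hv : v ∈ soloInformedOpenCube 2) :
    MvPolynomial.aeval (fun i => ∏ j, v j ^ soloInformedUpperMat i j) P /
        MvPolynomial.aeval (fun i => ∏ j, v j ^ soloInformedUpperMat i j) Q * v 1 =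
      MvPolynomial.aeval v (soloInformedChartQuot soloInformedUpperMat P 0) /
        MvPolynomial.aeval v (soloInformedDiagUpper Q) := by
  rw [soloInformed_aeval_upperChart_eq_mul_diagUpper Q hQ0 v,
    soloInformed_aeval_monomialMap_chartQuot_zero soloInformedUpperMat P v]
  have h0 : v 1 ≠ 0 := (hv 1).1.ne'
  have hq := soloInformed_aeval_diagUpper_ne_zero Q hQ0 hQ v hv
  field_simp

/-- **RULE DIAG.**  Let `Q ∈ ℚ[x₀, x₁]` with `Q(0,0) = 0` and without zero on the open square.  If
the two chart denominators `Q_low = Q(v₀, v₀v₁)/v₀` and `Q_up = Q(u₀u₁, u₁)/u₁` are presentable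
denominators, then so is `Q`: split the square along the diagonal (rule (1a)) and apply rule
(2) along the two triangle charts (THEOREM DIAG). [this work] -/
theorem soloInformed_presentableDen_of_diag (Q : MvPolynomial (Fin 2) ℚ)
    (hQ0 : MvPolynomial.coeff 0 Q = 0)
    (hQ : ∀ x ∈ soloInformedOpenCube 2, MvPolynomial.aeval x Q ≠ 0)
    (h₁ : SoloInformedPresentableDen (soloInformedDiagLower Q))
    (h₂ : SoloInformedPresentableDen (soloInformedDiagUpper Q)) :
    SoloInformedPresentableDen Q := fun P r hO hC hri =>
  soloInformed_presentable_of_diagonalCharts P Q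
    (soloInformedChartQuot soloInformedLowerMat P 0) (soloInformedDiagLower Q)
    (soloInformedChartQuot soloInformedUpperMat P 0) (soloInformedDiagUpper Q)
    (soloInformed_aeval_diagLower_ne_zero Q hQ0 hQ) (soloInformed_aeval_diagUpper_ne_zero Q hQ0 hQ)
    (soloInformed_diag_lowerChart_form P Q hQ0 hQ) (soloInformed_diag_upperChart_form P Q hQ0 hQ)
    (fun ρ hρ hρi => h₁ _ ρ (by rw [hρ]) (by rw [hρ]; exact soloInformedOpenCube_subset_cube 2) hρi)
    (fun ρ hρ hρi => h₂ _ ρ (by rw [hρ]) (by rw [hρ]; exact soloInformedOpenCube_subset_cube 2) hρi)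
    r hO hC hri

/-! ## THEOREM A_k inside the calculus -/

/-- `Q_m(0,0) = 0`. -/
theorem soloInformed_coeff_zero_akDen (m : ℕ) : MvPolynomial.coeff 0 (soloInformedAkDen m) = 0 := by
  rw [← MvPolynomial.constantCoeff_eq]
  simp [soloInformedAkDen]

/-- On the open square the lower chart denominator of `Q_m` is `Q₁ = x₀ ((1 − x₁)² + x₀^{m+1})`.
[this work] -/
theorem soloInformed_aeval_akLowerDen_eq_diagLower (m : ℕ) (v : Fin 2 → ℝ)
    (hv : v ∈ soloInformedOpenCube 2) :
    MvPolynomial.aeval v (soloInformedAkLowerDen m) =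
      MvPolynomial.aeval v (soloInformedDiagLower (soloInformedAkDen m)) := by
  have h0 : v 0 ≠ 0 := (hv 0).1.ne'
  refine mul_left_cancel₀ h0 ?_
  rw [← soloInformed_aeval_lowerChart_eq_mul_diagLower _ (soloInformed_coeff_zero_akDen m) v,
    soloInformed_aeval_akDen_lowerChart, soloInformed_aeval_akLowerDen]
  ring

/-- On the open square the upper chart denominator of `Q_m` is
`Q₂ = x₁ ((1 − x₀)² + x₀^{m+3} x₁^{m+1})`. [this work] -/
theorem soloInformed_aeval_akUpperDen_eq_diagUpper (m : ℕ) (v : Fin 2 → ℝ)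
    (hv : v ∈ soloInformedOpenCube 2) :
    MvPolynomial.aeval v (soloInformedAkUpperDen m) =
      MvPolynomial.aeval v (soloInformedDiagUpper (soloInformedAkDen m)) := by
  have h0 : v 1 ≠ 0 := (hv 1).1.ne'
  refine mul_left_cancel₀ h0 ?_
  rw [← soloInformed_aeval_upperChart_eq_mul_diagUpper _ (soloInformed_coeff_zero_akDen m) v,
    soloInformed_aeval_akDen_upperChart, soloInformed_aeval_akUpperDen]
  ring

/-- **THEOREM A_k inside the DEN-calculus**: `(x₀ − x₁)² + x₀^{m+3}` is a presentable denominator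
for every `m` — RULE DIAG, then RULE VERTEX at the far vertex of each chart square, then RULE
ND (the nondegeneracy certificates of `SoloInformedToricAkCharts`). [this work] -/
theorem soloInformed_presentableDen_ak (m : ℕ) : SoloInformedPresentableDen (soloInformedAkDen m) :=
  soloInformed_presentableDen_of_diag _ (soloInformed_coeff_zero_akDen m)
    (fun _ hx => (soloInformed_aeval_akDen_pos m hx).ne')
    (soloInformed_presentableDen_congr (soloInformed_aeval_akLowerDen_eq_diagLower m)
      (soloInformed_presentableDen_of_vertexReflect_nondegenerate {1}
        (soloInformed_cubeNondegenerate_vertexReflect_akLowerDen m)))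
    (soloInformed_presentableDen_congr (soloInformed_aeval_akUpperDen_eq_diagUpper m)
      (soloInformed_presentableDen_of_vertexReflect_nondegenerate {0}
        (soloInformed_cubeNondegenerate_vertexReflect_akUpperDen m)))

/-- The presentable denominators found so far (sample): the `ζ(2)` denominator, the cusp, the
whole `A`-family. [this work] -/
theorem soloInformed_presentableDen_examples (m : ℕ) :
    SoloInformedPresentableDen
        (MvPolynomial.X 0 + MvPolynomial.X 1 - MvPolynomial.X 0 * MvPolynomial.X 1 :
          MvPolynomial (Fin 2) ℚ) ∧
      SoloInformedPresentableDen soloInformedCuspDen ∧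
      SoloInformedPresentableDen (soloInformedAkDen m) :=
  ⟨soloInformed_presentableDen_of_nondegenerate soloInformed_cubeNondegenerate_zeta2Denominator,
    soloInformed_akDen_zero ▸ soloInformed_presentableDen_ak 0, soloInformed_presentableDen_ak m⟩

end Summit.KontsevichZagierPeriods.KontsevichZagierPeriods.Theorems
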